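import Summits.Parity.GeneralizedHardyLittlewood.Theorems.PrimeLevelFamEdgeMomentsBeyondDiagonalLayersEffectiveBox
import Summits.Parity.GeneralizedHardyLittlewood.Theorems.PrimeLevelFamEdgeMomentsBeyondDiagonalLayersTruncationError
import HarnessLib

/-!
# Route `PrimeLevelFamEdge`, crux K_A `MomentsBeyondDiagonal` (stmt-Parity-20007), line «petersson_layers» v4:
# the Bessel–Taylor truncation of ONE layer block on the effective box of the print band (assembly step E1, tools)

Tools for the fourth layer of the top-down assembly of `stub_farP` (`…LayersFormReduction.subFar_rhoP_of_form_bound`,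
after `…LayersBandFromLayerBound`, `…LayersLayerFromOrderBound`, `…LayersEffectiveBox`).  On the effective box
`d₁n₁'·d₂n₂' ≤ Y = ⌈q̂^{2+η}⌉` of the print band `⌊q̂^{ρ_P}⌋ < r ≤ ⌊q̂^{ρ_W}⌋` the Bessel argument `4π√(ab)/(qr)` is
`≤ 2 q̂^{−1/2}`, so each `(d₁, d₂)`-block of the order sum `I_{ij}^{≤Y}(r)` is, up to a super-polynomially small Leibniz
remainder, the finite sum over `k < K` of the separated forms of `…LayersTruncatedBlock.truncatedBlock_eq_sum_forms` with
coefficients `C_k(q,r) = (2π/q)·r⁻¹·c_k·(2π/(qr))^{2k+1}`, `|C_k| ≤ (2π)^{2k+2}/(qr)^{2k+2}`: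
* §1 `norm_block_sub_truncatedBlock_le_of_support`: the truncation error of `…LayersTruncationError` with the Taylor box
  condition asked only where the weight is non-zero (the indicator weight `1_{d₁n₁'d₂n₂' ≤ Y}` vanishes off the box);
* §2 the scales of the band: `q = 4π²q̂²`, `q̂^{11/10} < r ≤ q̂⁸`, `⌈q̂^{2+η}⌉ ≤ 2q̂^{21/10}` (`η ≤ 1/10`),
  `2π√(M²Y)/(qr) ≤ q̂^{−1/2}` and `2π²M²Y ≤ (qr)²` (`M = ⌊q̂^{Δ'}⌋`, `Δ' ≤ 3/2`);
* §3 `sum_block_weights_le`: the crude size `(Mq²)²·K L B²` of one block's weights;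
* §4 `norm_taylorCoeff_le`, **`norm_block_le_sum_forms_add`**:
  `‖Block(K_r-kernel)‖ ≤ Σ_{k<K} (2π)^{2k+2}/(qr)^{2k+2}·‖Form_k‖ + 2πρ·Σ‖W‖‖X₁‖‖X₂‖`.
Proof only (def-free helper); no layer is bounded here; K_A NOT proved; nothing about Landau–Siegel zeros.
-/

noncomputable section

open scoped Real Nat
open Complex Finset Polynomial MeasureTheory
open Literature.NumberTheory.LFunctions

namespace Summit.Parity.GeneralizedHardyLittlewood.Theorems.MomentsBeyondDiagonal.Layers

open Summit.Parity.GeneralizedHardyLittlewood.Theorems.PrimeLevelFamEdgeIdeaDeltas.PeterssonLayers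

/-! ## §1. The truncation error of a block, box condition on the support of the weight only -/

/-- **The truncation error of a block (support form)**: if every pair `(a, b) = (m₁n₁, m₂n₂)` of the block AT
WHICH `W(n₁,n₂) ≠ 0` satisfies `2π²ab ≤ (qr)²` and `(2π√(ab)/(qr))^{2K+1}/(K!(K+1)!) ≤ ρ`, then
`‖Block(κ) − Block(κ_K)‖ ≤ 2π ρ · Σ ‖W(n₁,n₂)‖ ‖X₁(m₁)‖ ‖X₂(m₂)‖` (`…LayersTruncationError.norm_block_sub_truncatedBlock_le`
asks the box condition everywhere). [cite: DLMF, 10.2.2; KowalskiMichel2000, §2.4.2 p. 312] -/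
theorem norm_block_sub_truncatedBlock_le_of_support (q : ℕ) [NeZero q] {r : ℕ} (hr : 0 < r)
    (S₁ T₁ S₂ T₂ : Finset ℕ) (W : ℕ → ℕ → ℂ) (X₁ X₂ : ℕ → ℂ) (K : ℕ) {ρ : ℝ}
    (hbox : ∀ m₁ ∈ S₁, ∀ n₁ ∈ T₁, ∀ m₂ ∈ S₂, ∀ n₂ ∈ T₂, W n₁ n₂ ≠ 0 →
      2 * π ^ 2 * (((m₁ * n₁ : ℕ) : ℝ) * ((m₂ * n₂ : ℕ) : ℝ)) ≤ ((q : ℝ) * r) ^ 2 ∧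
      (2 * π * Real.sqrt (((m₁ * n₁ : ℕ) : ℝ) * ((m₂ * n₂ : ℕ) : ℝ)) / ((q : ℝ) * r)) ^ (2 * K + 1) /
        ((K ! : ℝ) * ((K + 1)! : ℝ)) ≤ ρ) :
    haveI : NeZero (q * r) := ⟨mul_ne_zero (NeZero.ne q) hr.ne'⟩
    ‖∑ m₁ ∈ S₁, ∑ n₁ ∈ T₁, ∑ m₂ ∈ S₂, ∑ n₂ ∈ T₂,
        W n₁ n₂ * (X₁ m₁ * X₂ m₂ * layerKernel q r (m₁ * n₁) (m₂ * n₂)) -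
      ∑ m₁ ∈ S₁, ∑ n₁ ∈ T₁, ∑ m₂ ∈ S₂, ∑ n₂ ∈ T₂,
        W n₁ n₂ * (X₁ m₁ * X₂ m₂ *
          ((2 * (π : ℂ) / (q : ℂ)) * ((r : ℂ)⁻¹ *
            kloostermanSum (q * r) ((m₁ * n₁ : ℕ) : ZMod (q * r)) ((m₂ * n₂ : ℕ) : ZMod (q * r)) *
            ((∑ k ∈ range K, (-1 : ℝ) ^ k / ((k ! : ℝ) * ((k + 1)! : ℝ)) *
              ((2 * π / ((q : ℝ) * r)) ^ (2 * k + 1) * Real.sqrt ((m₁ * n₁ : ℕ) : ℝ) ^ (2 * k + 1) *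
                Real.sqrt ((m₂ * n₂ : ℕ) : ℝ) ^ (2 * k + 1)) : ℝ) : ℂ))))‖ ≤
      2 * π * ρ * ∑ m₁ ∈ S₁, ∑ n₁ ∈ T₁, ∑ m₂ ∈ S₂, ∑ n₂ ∈ T₂, ‖W n₁ n₂‖ * (‖X₁ m₁‖ * ‖X₂ m₂‖) := by
  haveI : NeZero (q * r) := ⟨mul_ne_zero (NeZero.ne q) hr.ne'⟩
  simp only [← Finset.sum_sub_distrib, ← mul_sub]
  rw [Finset.mul_sum]
  refine (norm_sum_le _ _).trans (Finset.sum_le_sum fun m₁ hm₁ ↦ ?_)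
  rw [Finset.mul_sum]
  refine (norm_sum_le _ _).trans (Finset.sum_le_sum fun n₁ hn₁ ↦ ?_)
  rw [Finset.mul_sum]
  refine (norm_sum_le _ _).trans (Finset.sum_le_sum fun m₂ hm₂ ↦ ?_)
  rw [Finset.mul_sum]
  refine (norm_sum_le _ _).trans (Finset.sum_le_sum fun n₂ hn₂ ↦ ?_)
  by_cases hW : W n₁ n₂ = 0
  · simp [hW]
  obtain ⟨hab, hrem⟩ := hbox m₁ hm₁ n₁ hn₁ m₂ hm₂ n₂ hn₂ hW
  have hk := norm_layerKernel_sub_truncation_le_trivial q hr (m₁ * n₁) (m₂ * n₂) K hab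
  rw [norm_mul, norm_mul, norm_mul]
  calc ‖W n₁ n₂‖ * (‖X₁ m₁‖ * ‖X₂ m₂‖ * ‖layerKernel q r (m₁ * n₁) (m₂ * n₂) -
          (2 * (π : ℂ) / (q : ℂ)) * ((r : ℂ)⁻¹ *
            kloostermanSum (q * r) ((m₁ * n₁ : ℕ) : ZMod (q * r)) ((m₂ * n₂ : ℕ) : ZMod (q * r)) *
            ((∑ k ∈ range K, (-1 : ℝ) ^ k / ((k ! : ℝ) * ((k + 1)! : ℝ)) *
              ((2 * π / ((q : ℝ) * r)) ^ (2 * k + 1) * Real.sqrt ((m₁ * n₁ : ℕ) : ℝ) ^ (2 * k + 1) *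
                Real.sqrt ((m₂ * n₂ : ℕ) : ℝ) ^ (2 * k + 1)) : ℝ) : ℂ))‖)
      ≤ ‖W n₁ n₂‖ * (‖X₁ m₁‖ * ‖X₂ m₂‖ * (2 * π * ρ)) := by
        refine mul_le_mul_of_nonneg_left (mul_le_mul_of_nonneg_left (hk.trans ?_) (by positivity)) (norm_nonneg _)
        exact mul_le_mul_of_nonneg_left hrem (by positivity)
    _ = 2 * π * ρ * (‖W n₁ n₂‖ * (‖X₁ m₁‖ * ‖X₂ m₂‖)) := by ring

/-! ## §2. The scales of the print band -/

/-- `q = 4π² q̂²` (`q̂ = √q/(2π)`). [cite: KowalskiMichelVanderKam2000, §1 (definition of q̂)] -/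
theorem natCast_eq_four_pi_sq_mul_qhat_sq (q : ℕ) : (q : ℝ) = 4 * π ^ 2 * KMV2000.qhat q ^ 2 := by
  have hq : (0 : ℝ) ≤ q := Nat.cast_nonneg q
  unfold KMV2000.qhat
  rw [div_pow, Real.sq_sqrt hq]
  field_simp
  ring

/-- In the print band the layer index exceeds `q̂^{ρ_P(Δ')} ≥ q̂^{11/10}`: for `q ≥ 64`, `Δ' > 1` and
`⌊q̂^{ρ_P(Δ')}⌋ + 1 ≤ r`, `q̂^{11/10} < r`. [folklore] -/
theorem qhat_rpow_lt_of_mem_band {q : ℕ} [NeZero q] (hq : 64 ≤ q) {Δ' : ℝ} (hΔ' : 1 < Δ') {r : ℕ}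
    (hr : layerCount q rhoP Δ' + 1 ≤ r) : KMV2000.qhat q ^ (11 / 10 : ℝ) < r := by
  have hqh1 : 1 < KMV2000.qhat q := one_lt_qhat hq
  have hρ : (11 / 10 : ℝ) ≤ rhoP Δ' := by
    unfold rhoP
    have : 5 * Δ' - 4 ≤ max (5 * Δ' - 4) (8 * Δ' - 8) := le_max_left _ _
    linarith
  have h1 : KMV2000.qhat q ^ (11 / 10 : ℝ) ≤ KMV2000.qhat q ^ rhoP Δ' :=
    Real.rpow_le_rpow_of_exponent_le hqh1.le hρ
  have h2 : KMV2000.qhat q ^ rhoP Δ' < ((layerCount q rhoP Δ' + 1 : ℕ) : ℝ) := by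
    unfold layerCount
    push_cast
    exact Nat.lt_floor_add_one _
  have h3 : ((layerCount q rhoP Δ' + 1 : ℕ) : ℝ) ≤ r := by exact_mod_cast hr
  exact lt_of_le_of_lt h1 (h2.trans_le h3)

/-- In the print band `r ≤ ⌊q̂^{ρ_W(Δ')}⌋ ≤ q̂⁸` (`1 < Δ' ≤ 3/2`, `q ≥ 64`). [folklore] -/
theorem le_qhat_rpow_eight_of_mem_band {q : ℕ} [NeZero q] (hq : 64 ≤ q) {Δ' : ℝ} (h₁ : 1 < Δ') (h₂ : Δ' ≤ 3 / 2)
    {r : ℕ} (hr : r ≤ layerCount q rhoWeil Δ') : (r : ℝ) ≤ KMV2000.qhat q ^ (8 : ℝ) := by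
  have hqh1 : 1 < KMV2000.qhat q := one_lt_qhat hq
  have hqh0 : 0 < KMV2000.qhat q := zero_lt_one.trans hqh1
  have h1 : (r : ℝ) ≤ ((layerCount q rhoWeil Δ' : ℕ) : ℝ) := by exact_mod_cast hr
  have h2 : ((layerCount q rhoWeil Δ' : ℕ) : ℝ) ≤ KMV2000.qhat q ^ rhoWeil Δ' := by
    unfold layerCount
    exact Nat.floor_le (Real.rpow_nonneg hqh0.le _)
  exact h1.trans (h2.trans (Real.rpow_le_rpow_of_exponent_le hqh1.le (rhoWeil_le_eight Δ' h₁ h₂)))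

/-- `⌈q̂^{2+η}⌉ ≤ 2 q̂^{21/10}` for `η ≤ 1/10`, `q̂ ≥ 1`. [folklore] -/
theorem ceil_le_two_mul_rpow {x η : ℝ} (hx : 1 ≤ x) (hη : η ≤ 1 / 10) :
    ((⌈x ^ (2 + η)⌉₊ : ℕ) : ℝ) ≤ 2 * x ^ (21 / 10 : ℝ) := by
  have hx0 : 0 < x := by linarith
  have h1 : x ^ (2 + η) ≤ x ^ (21 / 10 : ℝ) := Real.rpow_le_rpow_of_exponent_le hx (by linarith)
  have h2 : (1 : ℝ) ≤ x ^ (21 / 10 : ℝ) := Real.one_le_rpow hx (by norm_num)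
  have h3 : ((⌈x ^ (2 + η)⌉₊ : ℕ) : ℝ) < x ^ (2 + η) + 1 := Nat.ceil_lt_add_one (Real.rpow_nonneg hx0.le _)
  linarith

/-- **The Bessel argument is small on the effective box of the band**: for `q ≥ 64`, `Δ' ≤ 3/2`, `η ≤ 1/10` and
`q̂^{11/10} < r`, with `M = ⌊q̂^{Δ'}⌋`, `Y = ⌈q̂^{2+η}⌉`: `2π √(M²·Y)/(qr) ≤ q̂^{−1/2}`. [folklore] -/
theorem taylor_ratio_le {q : ℕ} [NeZero q] (hq : 64 ≤ q) {Δ' η : ℝ} (hΔ' : Δ' ≤ 3 / 2)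
    (hη : η ≤ 1 / 10) {r : ℕ} (hr : KMV2000.qhat q ^ (11 / 10 : ℝ) < r) :
    2 * π * Real.sqrt (((⌊KMV2000.qhat q ^ Δ'⌋₊ : ℕ) : ℝ) ^ 2 * ((⌈KMV2000.qhat q ^ (2 + η)⌉₊ : ℕ) : ℝ)) /
        ((q : ℝ) * r) ≤ KMV2000.qhat q ^ (-(1 / 2 : ℝ)) := by
  have hqh1 : 1 < KMV2000.qhat q := one_lt_qhat hq
  have hqh0 : 0 < KMV2000.qhat q := zero_lt_one.trans hqh1
  set x : ℝ := KMV2000.qhat q with hx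
  have hr0 : (0 : ℝ) < r := lt_trans (Real.rpow_pos_of_pos hqh0 _) hr
  have hq0 : (0 : ℝ) < q := by exact_mod_cast lt_of_lt_of_le (by norm_num : 0 < 64) hq
  -- `M ≤ x^{3/2}`, `Y ≤ 2 x^{21/10}`
  have hM : ((⌊x ^ Δ'⌋₊ : ℕ) : ℝ) ≤ x ^ (3 / 2 : ℝ) :=
    (Nat.floor_le (Real.rpow_nonneg hqh0.le _)).trans (Real.rpow_le_rpow_of_exponent_le hqh1.le hΔ')
  have hY : ((⌈x ^ (2 + η)⌉₊ : ℕ) : ℝ) ≤ 2 * x ^ (21 / 10 : ℝ) := ceil_le_two_mul_rpow hqh1.le hη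
  -- `√(M² Y) ≤ x^{3/2} · √2 · x^{21/20}`
  have hsq : Real.sqrt (((⌊x ^ Δ'⌋₊ : ℕ) : ℝ) ^ 2 * ((⌈x ^ (2 + η)⌉₊ : ℕ) : ℝ)) ≤
      x ^ (3 / 2 : ℝ) * Real.sqrt (2 * x ^ (21 / 10 : ℝ)) := by
    rw [Real.sqrt_mul (sq_nonneg _), Real.sqrt_sq (Nat.cast_nonneg _)]
    exact mul_le_mul hM (Real.sqrt_le_sqrt hY) (Real.sqrt_nonneg _) (Real.rpow_nonneg hqh0.le _)
  have hsq2 : Real.sqrt (2 * x ^ (21 / 10 : ℝ)) = Real.sqrt 2 * x ^ (21 / 20 : ℝ) := by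
    rw [Real.sqrt_mul (by norm_num : (0 : ℝ) ≤ 2)]
    congr 1
    rw [Real.sqrt_eq_rpow, ← Real.rpow_mul hqh0.le]
    norm_num
  have hs2 : Real.sqrt 2 ≤ 2 := by
    rw [show (2 : ℝ) = Real.sqrt 4 by rw [show (4 : ℝ) = 2 ^ 2 by norm_num, Real.sqrt_sq (by norm_num)]]
    exact Real.sqrt_le_sqrt (by norm_num)
  -- denominator `q r ≥ 4π² x² · x^{11/10}`
  have hq : (q : ℝ) = 4 * π ^ 2 * x ^ 2 := by rw [hx]; exact natCast_eq_four_pi_sq_mul_qhat_sq q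
  have hden : 4 * π ^ 2 * x ^ 2 * x ^ (11 / 10 : ℝ) ≤ (q : ℝ) * r := by
    rw [hq]
    exact mul_le_mul_of_nonneg_left hr.le (by positivity)
  have hden0 : 0 < 4 * π ^ 2 * x ^ 2 * x ^ (11 / 10 : ℝ) := by positivity
  rw [div_le_iff₀ (by positivity)]
  -- target: `2π √(M²Y) ≤ x^{-1/2} · (q r)`
  have hnum : 2 * π * Real.sqrt (((⌊x ^ Δ'⌋₊ : ℕ) : ℝ) ^ 2 * ((⌈x ^ (2 + η)⌉₊ : ℕ) : ℝ)) ≤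
      2 * π * (x ^ (3 / 2 : ℝ) * (2 * x ^ (21 / 20 : ℝ))) := by
    refine mul_le_mul_of_nonneg_left (hsq.trans ?_) (by positivity)
    rw [hsq2]
    exact mul_le_mul_of_nonneg_left (mul_le_mul_of_nonneg_right hs2 (Real.rpow_nonneg hqh0.le _))
      (Real.rpow_nonneg hqh0.le _)
  refine hnum.trans ?_
  have hrhs : x ^ (-(1 / 2 : ℝ)) * (4 * π ^ 2 * x ^ 2 * x ^ (11 / 10 : ℝ)) ≤ x ^ (-(1 / 2 : ℝ)) * ((q : ℝ) * r) :=
    mul_le_mul_of_nonneg_left hden (Real.rpow_nonneg hqh0.le _)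
  refine le_trans ?_ hrhs
  -- `4π x^{3/2} x^{21/20} ≤ 4π² x^{-1/2} x² x^{11/10}`, i.e. `x^{51/20} ≤ π x^{52/20}`
  have e1 : 2 * π * (x ^ (3 / 2 : ℝ) * (2 * x ^ (21 / 20 : ℝ))) = 4 * π * x ^ (51 / 20 : ℝ) := by
    rw [show (51 / 20 : ℝ) = 3 / 2 + 21 / 20 by norm_num, Real.rpow_add hqh0]
    ring
  have e2 : x ^ (-(1 / 2 : ℝ)) * (4 * π ^ 2 * x ^ 2 * x ^ (11 / 10 : ℝ)) = 4 * π ^ 2 * x ^ (52 / 20 : ℝ) := by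
    rw [← Real.rpow_natCast x 2, show (52 / 20 : ℝ) = -(1 / 2) + (2 : ℕ) + 11 / 10 by norm_num,
      Real.rpow_add hqh0, Real.rpow_add hqh0]
    ring
  rw [e1, e2]
  have h51 : x ^ (51 / 20 : ℝ) ≤ x ^ (52 / 20 : ℝ) := Real.rpow_le_rpow_of_exponent_le hqh1.le (by norm_num)
  have hπ1 : (4 : ℝ) * π ≤ 4 * π ^ 2 := by nlinarith [Real.pi_gt_three]
  exact mul_le_mul hπ1 h51 (Real.rpow_nonneg hqh0.le _) (by positivity)

/-- **The Taylor box condition on the effective box of the band**: `2π²·(M²·Y) ≤ (qr)²` (same hypotheses). [folklore] -/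
theorem taylor_box_le {q : ℕ} [NeZero q] (hq : 64 ≤ q) {Δ' η : ℝ} (hΔ' : Δ' ≤ 3 / 2)
    (hη : η ≤ 1 / 10) {r : ℕ} (hr : KMV2000.qhat q ^ (11 / 10 : ℝ) < r) :
    2 * π ^ 2 * ((((⌊KMV2000.qhat q ^ Δ'⌋₊ : ℕ) : ℝ)) ^ 2 * ((⌈KMV2000.qhat q ^ (2 + η)⌉₊ : ℕ) : ℝ)) ≤
      ((q : ℝ) * r) ^ 2 := by
  have hqh1 : 1 < KMV2000.qhat q := one_lt_qhat hq
  have hqh0 : 0 < KMV2000.qhat q := zero_lt_one.trans hqh1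
  have h := taylor_ratio_le hq hΔ' hη hr
  have hr0 : (0 : ℝ) < r := lt_trans (Real.rpow_pos_of_pos hqh0 _) hr
  have hq0 : (0 : ℝ) < q := by exact_mod_cast lt_of_lt_of_le (by norm_num : 0 < 64) hq
  have hqr : (0 : ℝ) < (q : ℝ) * r := by positivity
  set S : ℝ := (((⌊KMV2000.qhat q ^ Δ'⌋₊ : ℕ) : ℝ)) ^ 2 * ((⌈KMV2000.qhat q ^ (2 + η)⌉₊ : ℕ) : ℝ) with hS
  have hS0 : 0 ≤ S := by positivity
  have hle1 : KMV2000.qhat q ^ (-(1 / 2 : ℝ)) ≤ 1 :=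
    Real.rpow_le_one_of_one_le_of_nonpos hqh1.le (by norm_num)
  have hratio : 2 * π * Real.sqrt S / ((q : ℝ) * r) ≤ 1 := h.trans hle1
  rw [div_le_iff₀ hqr, one_mul] at hratio
  -- square: `4π² S ≤ (qr)²`, and `2π² S ≤ 4π² S`
  have hsq : (2 * π * Real.sqrt S) ^ 2 ≤ ((q : ℝ) * r) ^ 2 := pow_le_pow_left₀ (by positivity) hratio 2
  rw [mul_pow, Real.sq_sqrt hS0] at hsq
  nlinarith [Real.pi_pos, hS0]

/-! ## §3. The crude size of one block's weights -/

/-- On the block, `‖1_{d₁n₁d₂n₂≤Y}(d₁n₁d₂n₂)^{−1/2}W_{ij}(d₁n₁,d₂n₂)‖ ≤ K·L` and `‖x_{dm}‖ ≤ B`, so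
`Σ_{block} ‖W‖‖X₁‖‖X₂‖ ≤ (M q²)² · K L B²` (`q ≥ 64`, `Δ' > 0`, `K` a weight constant at decay exponent `0`). [folklore] -/
theorem sum_block_weights_le {q : ℕ} [NeZero q] (h64 : 64 ≤ q) {P : ℝ[X]} {B : ℝ}
    (hB : ∀ t ∈ Set.Icc (0 : ℝ) 1, |P.eval t| ≤ B) {Δ' : ℝ} (hΔ' : 0 < Δ') (i j : ℕ) {K : ℝ} (hK0 : 0 ≤ K)
    (hK : ∀ {N₁ N₂ : ℕ}, N₁ ∈ afeBox q → N₂ ∈ afeBox q →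
      ‖((((N₁ : ℝ) * N₂) ^ (-(1 / 2 : ℝ)) : ℝ) : ℂ) * afeW (KMV2000.qhat q) i j N₁ N₂‖ *
          Real.sqrt ((N₁ : ℝ) * N₂) ≤
        K * ((1 + Real.log (KMV2000.qhat q)) * (1 + 2 * Real.log q)) ^ (i + j) *
          (KMV2000.qhat q ^ 2 / ((N₁ : ℝ) * N₂)) ^ (0 : ℝ))
    (Y : ℕ) {d₁ d₂ : ℕ} (hd₁ : d₁ ∈ Icc 1 ⌊KMV2000.qhat q ^ Δ'⌋₊) (hd₂ : d₂ ∈ Icc 1 ⌊KMV2000.qhat q ^ Δ'⌋₊) :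
    ∑ m₁ ∈ Icc 1 (⌊KMV2000.qhat q ^ Δ'⌋₊ / d₁), ∑ n₁ ∈ Icc 1 (q ^ 2 / d₁),
      ∑ m₂ ∈ Icc 1 (⌊KMV2000.qhat q ^ Δ'⌋₊ / d₂), ∑ n₂ ∈ Icc 1 (q ^ 2 / d₂),
        ‖(if d₁ * n₁ * (d₂ * n₂) ≤ Y then
            ((((((d₁ * n₁ : ℕ) : ℝ) * ((d₂ * n₂ : ℕ) : ℝ)) ^ (-(1 / 2 : ℝ)) : ℝ) : ℂ) *
              afeW (KMV2000.qhat q) i j (d₁ * n₁) (d₂ * n₂)) else 0)‖ *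
          (‖(KMV2000.mollifierCoeff P (KMV2000.qhat q ^ Δ') (d₁ * m₁) : ℂ)‖ *
            ‖(KMV2000.mollifierCoeff P (KMV2000.qhat q ^ Δ') (d₂ * m₂) : ℂ)‖) ≤
      ((⌊KMV2000.qhat q ^ Δ'⌋₊ : ℝ) * (q : ℝ) ^ 2) ^ 2 *
        (K * ((1 + Real.log (KMV2000.qhat q)) * (1 + 2 * Real.log q)) ^ (i + j) * B ^ 2) := by
  have hqh1 : 1 < KMV2000.qhat q := one_lt_qhat h64
  have hqh0 : 0 < KMV2000.qhat q := zero_lt_one.trans hqh1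
  have hM1 : 1 < KMV2000.qhat q ^ Δ' := Real.one_lt_rpow hqh1 hΔ'
  have hB0 : 0 ≤ B := le_trans (abs_nonneg _) (hB 0 (by simp))
  set L : ℝ := ((1 + Real.log (KMV2000.qhat q)) * (1 + 2 * Real.log q)) ^ (i + j) with hL
  have hL0 : 0 ≤ L := by
    rw [hL]
    refine pow_nonneg (mul_nonneg ?_ ?_) _
    · linarith [Real.log_nonneg hqh1.le]
    · have : (1 : ℝ) ≤ q := by exact_mod_cast (le_trans (by norm_num) h64 : 1 ≤ q)
      linarith [Real.log_nonneg this]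
  set Mf : ℕ := ⌊KMV2000.qhat q ^ Δ'⌋₊ with hMf
  have hd₁1 : 1 ≤ d₁ := (mem_Icc.mp hd₁).1
  have hd₂1 : 1 ≤ d₂ := (mem_Icc.mp hd₂).1
  -- termwise bound by the constant `K L B²`
  have hterm : ∀ m₁ ∈ Icc 1 (Mf / d₁), ∀ n₁ ∈ Icc 1 (q ^ 2 / d₁), ∀ m₂ ∈ Icc 1 (Mf / d₂), ∀ n₂ ∈ Icc 1 (q ^ 2 / d₂),
      ‖(if d₁ * n₁ * (d₂ * n₂) ≤ Y then
            ((((((d₁ * n₁ : ℕ) : ℝ) * ((d₂ * n₂ : ℕ) : ℝ)) ^ (-(1 / 2 : ℝ)) : ℝ) : ℂ) *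
              afeW (KMV2000.qhat q) i j (d₁ * n₁) (d₂ * n₂)) else 0)‖ *
          (‖(KMV2000.mollifierCoeff P (KMV2000.qhat q ^ Δ') (d₁ * m₁) : ℂ)‖ *
            ‖(KMV2000.mollifierCoeff P (KMV2000.qhat q ^ Δ') (d₂ * m₂) : ℂ)‖) ≤ K * L * B ^ 2 := by
    intro m₁ hm₁ n₁ hn₁ m₂ hm₂ n₂ hn₂
    have hM₁ : d₁ * m₁ ∈ Icc 1 Mf := mul_mem_Icc_of_mem_div hd₁1 hm₁
    have hM₂ : d₂ * m₂ ∈ Icc 1 Mf := mul_mem_Icc_of_mem_div hd₂1 hm₂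
    have hN₁ : d₁ * n₁ ∈ afeBox q := by unfold afeBox; exact mul_mem_Icc_of_mem_div hd₁1 hn₁
    have hN₂ : d₂ * n₂ ∈ afeBox q := by unfold afeBox; exact mul_mem_Icc_of_mem_div hd₂1 hn₂
    -- `‖x_{dm}‖ ≤ B (dm)^{-1/2} ≤ B`
    have hx : ∀ {d m : ℕ}, d * m ∈ Icc 1 Mf →
        ‖(KMV2000.mollifierCoeff P (KMV2000.qhat q ^ Δ') (d * m) : ℂ)‖ ≤ B := by
      intro d m hdm
      refine (norm_mollifierCoeff_le hB hM1 hdm).trans ?_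
      have h1 : (1 : ℝ) ≤ ((d * m : ℕ) : ℝ) := by exact_mod_cast (mem_Icc.mp hdm).1
      have h2 : ((d * m : ℕ) : ℝ) ^ (-(1 / 2 : ℝ)) ≤ 1 :=
        Real.rpow_le_one_of_one_le_of_nonpos h1 (by norm_num)
      calc B * ((d * m : ℕ) : ℝ) ^ (-(1 / 2 : ℝ)) ≤ B * 1 := mul_le_mul_of_nonneg_left h2 hB0
        _ = B := mul_one B
    -- the weight: `‖w‖ √(N₁N₂) ≤ K L` and `√(N₁N₂) ≥ 1`
    have hw : ‖(if d₁ * n₁ * (d₂ * n₂) ≤ Y then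
            ((((((d₁ * n₁ : ℕ) : ℝ) * ((d₂ * n₂ : ℕ) : ℝ)) ^ (-(1 / 2 : ℝ)) : ℝ) : ℂ) *
              afeW (KMV2000.qhat q) i j (d₁ * n₁) (d₂ * n₂)) else 0)‖ ≤ K * L := by
      split_ifs with hc
      · have h := hK hN₁ hN₂
        rw [Real.rpow_zero, mul_one] at h
        have hN1 : (1 : ℝ) ≤ ((d₁ * n₁ : ℕ) : ℝ) * ((d₂ * n₂ : ℕ) : ℝ) := by
          have h₁ : (1 : ℝ) ≤ ((d₁ * n₁ : ℕ) : ℝ) := by exact_mod_cast (mem_Icc.mp hN₁).1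
          have h₂ : (1 : ℝ) ≤ ((d₂ * n₂ : ℕ) : ℝ) := by exact_mod_cast (mem_Icc.mp hN₂).1
          nlinarith
        have hs1 : (1 : ℝ) ≤ Real.sqrt (((d₁ * n₁ : ℕ) : ℝ) * ((d₂ * n₂ : ℕ) : ℝ)) := by
          rw [show (1 : ℝ) = Real.sqrt 1 by simp]
          exact Real.sqrt_le_sqrt hN1
        calc _ = ‖((((((d₁ * n₁ : ℕ) : ℝ)) * ((d₂ * n₂ : ℕ) : ℝ)) ^ (-(1 / 2 : ℝ)) : ℝ) : ℂ) *
              afeW (KMV2000.qhat q) i j (d₁ * n₁) (d₂ * n₂)‖ * 1 := (mul_one _).symm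
          _ ≤ ‖((((((d₁ * n₁ : ℕ) : ℝ)) * ((d₂ * n₂ : ℕ) : ℝ)) ^ (-(1 / 2 : ℝ)) : ℝ) : ℂ) *
              afeW (KMV2000.qhat q) i j (d₁ * n₁) (d₂ * n₂)‖ *
              Real.sqrt (((d₁ * n₁ : ℕ) : ℝ) * ((d₂ * n₂ : ℕ) : ℝ)) :=
            mul_le_mul_of_nonneg_left hs1 (norm_nonneg _)
          _ ≤ K * L := by
            have e : (((d₁ * n₁ : ℕ) : ℝ)) * ((d₂ * n₂ : ℕ) : ℝ) = ((d₁ * n₁ : ℕ) : ℝ) * ((d₂ * n₂ : ℕ) : ℝ) := rfl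
            simpa [hL] using h
      · rw [norm_zero]; positivity
    calc _ ≤ (K * L) * (B * B) :=
          mul_le_mul hw (mul_le_mul (hx hM₁) (hx hM₂) (norm_nonneg _) hB0) (by positivity) (by positivity)
      _ = K * L * B ^ 2 := by ring
  -- sum of a constant over the box
  have hcard : ∀ {d : ℕ}, 1 ≤ d → ((#(Icc 1 (Mf / d)) : ℝ)) * (#(Icc 1 (q ^ 2 / d)) : ℝ) ≤ (Mf : ℝ) * (q : ℝ) ^ 2 := by
    intro d hd
    rw [Nat.card_Icc, Nat.card_Icc]
    have h1 : ((Mf / d + 1 - 1 : ℕ) : ℝ) ≤ Mf := by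
      rw [Nat.add_sub_cancel]; exact_mod_cast Nat.div_le_self _ _
    have h2 : ((q ^ 2 / d + 1 - 1 : ℕ) : ℝ) ≤ (q : ℝ) ^ 2 := by
      rw [Nat.add_sub_cancel]; exact_mod_cast Nat.div_le_self _ _
    exact mul_le_mul h1 h2 (Nat.cast_nonneg _) (Nat.cast_nonneg _)
  calc _ ≤ ∑ _m₁ ∈ Icc 1 (Mf / d₁), ∑ _n₁ ∈ Icc 1 (q ^ 2 / d₁), ∑ _m₂ ∈ Icc 1 (Mf / d₂), ∑ _n₂ ∈ Icc 1 (q ^ 2 / d₂),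
          K * L * B ^ 2 :=
        sum_le_sum fun m₁ hm₁ ↦ sum_le_sum fun n₁ hn₁ ↦ sum_le_sum fun m₂ hm₂ ↦ sum_le_sum fun n₂ hn₂ ↦
          hterm m₁ hm₁ n₁ hn₁ m₂ hm₂ n₂ hn₂
    _ = (((#(Icc 1 (Mf / d₁)) : ℝ)) * (#(Icc 1 (q ^ 2 / d₁)) : ℝ)) *
          ((((#(Icc 1 (Mf / d₂)) : ℝ)) * (#(Icc 1 (q ^ 2 / d₂)) : ℝ))) * (K * L * B ^ 2) := by
        simp only [sum_const, nsmul_eq_mul]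
        ring
    _ ≤ ((Mf : ℝ) * (q : ℝ) ^ 2) * ((Mf : ℝ) * (q : ℝ) ^ 2) * (K * L * B ^ 2) := by
        refine mul_le_mul_of_nonneg_right ?_ (by positivity)
        exact mul_le_mul (hcard hd₁1) (hcard hd₂1) (by positivity) (by positivity)
    _ = _ := by rw [hL]; ring

/-! ## §4. One block: coefficients, forms and the truncation error -/

/-- The `k`-th Taylor coefficient of a layer block: `‖(2π/q)·r⁻¹·c_k·(2π/(qr))^{2k+1}‖ ≤ (2π)^{2k+2}/(qr)^{2k+2}`
(`|c_k| = 1/(k!(k+1)!) ≤ 1`; `q, r ≥ 1`). [cite: DLMF, 10.2.2] -/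
theorem norm_taylorCoeff_le {q r : ℕ} (hq : 0 < q) (hr : 0 < r) (k : ℕ) :
    ‖(2 * (π : ℂ) / (q : ℂ)) * (r : ℂ)⁻¹ *
        (((-1 : ℝ) ^ k / ((k ! : ℝ) * ((k + 1)! : ℝ)) * (2 * π / ((q : ℝ) * r)) ^ (2 * k + 1) : ℝ) : ℂ)‖ ≤
      (2 * π) ^ (2 * k + 2) / ((q : ℝ) * r) ^ (2 * k + 2) := by
  have hq0 : (0 : ℝ) < q := by exact_mod_cast hq
  have hr0 : (0 : ℝ) < r := by exact_mod_cast hr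
  have h1 : ‖(2 * (π : ℂ) / (q : ℂ))‖ = 2 * π / (q : ℝ) := by
    rw [norm_div, Complex.norm_natCast]
    congr 1
    rw [Complex.norm_mul, Complex.norm_real, Real.norm_eq_abs, abs_of_pos Real.pi_pos, Complex.norm_two]
  rw [norm_mul, norm_mul, h1, norm_inv, Complex.norm_natCast, Complex.norm_real, Real.norm_eq_abs, abs_mul, abs_div,
    abs_pow, abs_neg, abs_one, one_pow, abs_of_pos (by positivity : (0 : ℝ) < (k ! : ℝ) * ((k + 1)! : ℝ)),
    abs_of_nonneg (by positivity : (0 : ℝ) ≤ (2 * π / ((q : ℝ) * r)) ^ (2 * k + 1))]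
  have hfac : (1 : ℝ) / ((k ! : ℝ) * ((k + 1)! : ℝ)) ≤ 1 := by
    rw [div_le_one (by positivity)]
    have h₁ : (1 : ℝ) ≤ (k ! : ℝ) := by exact_mod_cast Nat.one_le_iff_ne_zero.mpr (Nat.factorial_ne_zero k)
    have h₂ : (1 : ℝ) ≤ ((k + 1)! : ℝ) := by exact_mod_cast Nat.one_le_iff_ne_zero.mpr (Nat.factorial_ne_zero _)
    nlinarith
  calc 2 * π / (q : ℝ) * ((r : ℝ))⁻¹ * (1 / ((k ! : ℝ) * ((k + 1)! : ℝ)) * (2 * π / ((q : ℝ) * r)) ^ (2 * k + 1))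
      ≤ 2 * π / (q : ℝ) * ((r : ℝ))⁻¹ * (1 * (2 * π / ((q : ℝ) * r)) ^ (2 * k + 1)) := by
        gcongr
    _ = (2 * π / ((q : ℝ) * r)) ^ (2 * k + 2) := by
        rw [one_mul, ← div_eq_mul_inv, div_div, pow_succ' _ (2 * k + 1)]
    _ = (2 * π) ^ (2 * k + 2) / ((q : ℝ) * r) ^ (2 * k + 2) := div_pow _ _ _

/-- **One block against its separated forms** (`q, r ≥ 1`): if the Taylor box condition holds on the support of `W`
with remainder bound `ρ ≥ 0`, then
`‖Block(K_r-kernel)‖ ≤ Σ_{k<K} (2π)^{2k+2}/(qr)^{2k+2} · ‖Form_k‖ + 2πρ · Σ ‖W‖‖X₁‖‖X₂‖`,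
`Form_k = Σ [X₁X₂(√m₁√m₂)^{2k+1}]·[W(√n₁√n₂)^{2k+1}]·S(m₁n₁, m₂n₂; qr)` (`truncatedBlock_eq_sum_forms` +
`norm_block_sub_truncatedBlock_le_of_support`). [cite: DLMF, 10.2.2; KowalskiMichel2000, §2.4.2 p. 312] -/
theorem norm_block_le_sum_forms_add (q : ℕ) [NeZero q] {r : ℕ} (hr : 0 < r)
    (S₁ T₁ S₂ T₂ : Finset ℕ) (W : ℕ → ℕ → ℂ) (X₁ X₂ : ℕ → ℂ) (K : ℕ) {ρ : ℝ}
    (hbox : ∀ m₁ ∈ S₁, ∀ n₁ ∈ T₁, ∀ m₂ ∈ S₂, ∀ n₂ ∈ T₂, W n₁ n₂ ≠ 0 →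
      2 * π ^ 2 * (((m₁ * n₁ : ℕ) : ℝ) * ((m₂ * n₂ : ℕ) : ℝ)) ≤ ((q : ℝ) * r) ^ 2 ∧
      (2 * π * Real.sqrt (((m₁ * n₁ : ℕ) : ℝ) * ((m₂ * n₂ : ℕ) : ℝ)) / ((q : ℝ) * r)) ^ (2 * K + 1) /
        ((K ! : ℝ) * ((K + 1)! : ℝ)) ≤ ρ) :
    haveI : NeZero (q * r) := ⟨mul_ne_zero (NeZero.ne q) hr.ne'⟩
    ‖∑ m₁ ∈ S₁, ∑ n₁ ∈ T₁, ∑ m₂ ∈ S₂, ∑ n₂ ∈ T₂,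
        W n₁ n₂ * (X₁ m₁ * X₂ m₂ * layerKernel q r (m₁ * n₁) (m₂ * n₂))‖ ≤
      ∑ k ∈ range K, (2 * π) ^ (2 * k + 2) / ((q : ℝ) * r) ^ (2 * k + 2) *
          ‖∑ m₁ ∈ S₁, ∑ n₁ ∈ T₁, ∑ m₂ ∈ S₂, ∑ n₂ ∈ T₂,
            (X₁ m₁ * X₂ m₂ * ((Real.sqrt m₁ ^ (2 * k + 1) * Real.sqrt m₂ ^ (2 * k + 1) : ℝ) : ℂ)) *
              (W n₁ n₂ * ((Real.sqrt n₁ ^ (2 * k + 1) * Real.sqrt n₂ ^ (2 * k + 1) : ℝ) : ℂ)) *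
              kloostermanSum (q * r) ((m₁ * n₁ : ℕ) : ZMod (q * r)) ((m₂ * n₂ : ℕ) : ZMod (q * r))‖ +
        2 * π * ρ * ∑ m₁ ∈ S₁, ∑ n₁ ∈ T₁, ∑ m₂ ∈ S₂, ∑ n₂ ∈ T₂, ‖W n₁ n₂‖ * (‖X₁ m₁‖ * ‖X₂ m₂‖) := by
  haveI : NeZero (q * r) := ⟨mul_ne_zero (NeZero.ne q) hr.ne'⟩
  have hq : 0 < q := Nat.pos_of_ne_zero (NeZero.ne q)
  have herr := norm_block_sub_truncatedBlock_le_of_support q hr S₁ T₁ S₂ T₂ W X₁ X₂ K hbox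
  have hforms := truncatedBlock_eq_sum_forms q r S₁ T₁ S₂ T₂ W X₁ X₂ K
  -- `Block(κ) = Block(κ_K) + (Block(κ) − Block(κ_K))`
  have hsplit : ∀ a b : ℂ, a = b + (a - b) := fun a b ↦ by ring
  rw [hsplit (∑ m₁ ∈ S₁, ∑ n₁ ∈ T₁, ∑ m₂ ∈ S₂, ∑ n₂ ∈ T₂,
        W n₁ n₂ * (X₁ m₁ * X₂ m₂ * layerKernel q r (m₁ * n₁) (m₂ * n₂)))
      (∑ m₁ ∈ S₁, ∑ n₁ ∈ T₁, ∑ m₂ ∈ S₂, ∑ n₂ ∈ T₂,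
        W n₁ n₂ * (X₁ m₁ * X₂ m₂ *
          ((2 * (π : ℂ) / (q : ℂ)) * ((r : ℂ)⁻¹ *
            kloostermanSum (q * r) ((m₁ * n₁ : ℕ) : ZMod (q * r)) ((m₂ * n₂ : ℕ) : ZMod (q * r)) *
            ((∑ k ∈ range K, (-1 : ℝ) ^ k / ((k ! : ℝ) * ((k + 1)! : ℝ)) *
              ((2 * π / ((q : ℝ) * r)) ^ (2 * k + 1) * Real.sqrt ((m₁ * n₁ : ℕ) : ℝ) ^ (2 * k + 1) *
                Real.sqrt ((m₂ * n₂ : ℕ) : ℝ) ^ (2 * k + 1)) : ℝ) : ℂ)))))]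
  refine (norm_add_le _ _).trans (add_le_add ?_ herr)
  rw [hforms]
  refine (norm_sum_le _ _).trans (sum_le_sum fun k _ ↦ ?_)
  rw [norm_mul]
  exact mul_le_mul_of_nonneg_right (norm_taylorCoeff_le hq hr k) (norm_nonneg _)

end Summit.Parity.GeneralizedHardyLittlewood.Theorems.MomentsBeyondDiagonal.Layers

end
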